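import Summits.NavierStokesRegularity.NavierStokesRegularity.Theorems.HardyPointSinkHardyAncientLimitSelection
import Summits.NavierStokesRegularity.NavierStokesRegularity.Theorems.HardyPointSinkHardyAncientLimitRescaled
import Summits.NavierStokesRegularity.NavierStokesRegularity.Theorems.HardyPointSinkHardyAncientLimitScaledBounds
import Summits.NavierStokesRegularity.NavierStokesRegularity.Theorems.HardyPointSinkHardyAncientLimitPressureA
import Summits.NavierStokesRegularity.NavierStokesRegularity.Theorems.HardyPointSinkHardyAncientLimitPressureB
import Summits.NavierStokesRegularity.NavierStokesRegularity.Theorems.HardyPointSinkHardyAncientLimitPressureD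
import Literature.Analysis.FluidPDE.ClassicalSolutionRescale
import Literature.Analysis.FluidPDE.PeriodicBoundedMildTorus
import Literature.Analysis.FluidPDE.LocalTypeIScaling
import HarnessLib

/-!
# Route HardyPointSink — `HardyAncientLimit`, step 9a: the blow-up sequence and its pressures

Support file for item stmt-NavierStokesRegularity-9138 (`HardyAncientLimit`) of route
`HardyPointSink` (problem `NavierStokesRegularity`).

In the zoomed frame (`(u₁, p₁)` classical on `]-1, 0[ × ℝ³`, continuous on `Q(1)`, singular at
the origin) we fix the blow-up sequence of Seregin–Šverák 2009, §4 — near-maximum centres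
`z_k ∈ Q(1/8)`, scales `c_k = 1/(2|u₁(z_k)|) ≤ 1/(20(k+1))` (`HardyAncientLimit.exists_centres`) —
and record, for the rescaled fields `U_k = c_k u₁ ∘ Φ_k`:

* `HardyAncientLimit.exists_blowup_sequence` — continuity and the bound `|U_k| ≤ 1` on every
  `𝒞(a) × ]-a², 0]` for large `k`, and the normalisation `c_k |u₁(z_k)| = 1/2`;
* for the rescaled *clamped* pressures `q_k = c_k² p₁(· ∨ (-1/2)) ∘ Φ_k` (the pressure is frozen
  below `t = -1/2`, where it is never used, so that `q_k` is continuous on `{s ≤ 0} × ℝ³`):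
  `HardyAncientLimit.continuousOn_clampedPressure`, `HardyAncientLimit.eventually_isDistributional_clamped`
  (classical, hence distributional, on every `Q(a)` for large `k`),
  `HardyAncientLimit.eventually_cknDOsc_clamped_le` (`D(Q(z,r); q_k) ≤ 𝐈₀` for large `k`, by
  scale invariance and the invariance of `D` under functions of time), and the uniform local
  `L^{3/2}` bounds of the gauged pressures consumed by the compactness step,
  `HardyAncientLimit.exists_pressure_bound`.

## References

* G. Seregin, V. Šverák, Comm. PDE 34 (2009), §4.
* D. Albritton, T. Barker, arXiv:1811.00502, §3.
-/

noncomputable section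

open Literature.Analysis.FluidPDE Literature.Analysis.FluidPDE.SereginSverak2009
open MeasureTheory Set Function Filter Topology Metric TopologicalSpace
open scoped ENNReal NNReal

namespace Summit.NavierStokesRegularity.NavierStokesRegularity.Theorems

namespace HardyAncientLimit

/-! ### The blow-up sequence -/

/-- Eventually `a ≤ k + 1`. [folklore] -/
theorem eventually_le_natCast_add_one (a : ℝ) : ∀ᶠ k : ℕ in atTop, a ≤ (k : ℝ) + 1 := by
  refine eventually_atTop.2 ⟨⌈a⌉₊, fun k hk => ?_⟩
  have h1 : a ≤ (⌈a⌉₊ : ℝ) := Nat.le_ceil a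
  have h2 : ((⌈a⌉₊ : ℕ) : ℝ) ≤ (k : ℝ) := by exact_mod_cast hk
  linarith

/-- **The blow-up sequence** (Seregin–Šverák 2009, §4, (p1)–(p4)). For `u₁` continuous on
`Q(1)` and not essentially bounded near the origin there are centres `z_k ∈ Q(1/8)` and scales
`0 < c_k ≤ 1/(20(k+1))` with `c_k |u₁(z_k)| = 1/2` such that the rescaled fields
`U_k(s, y) = c_k u₁(t_k + c_k² s, x_k + c_k y)` are, for large `k`, continuous and bounded by `1`
on every `𝒞(a) × ]-a², 0]`. [cite: SereginSverak2009, §4 (p1)–(p4) (arXiv p. 11)] -/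
theorem exists_blowup_sequence
    {u₁ : ℝ → EuclideanSpace ℝ (Fin 3) → EuclideanSpace ℝ (Fin 3)}
    (hcont₁ : ContinuousOn (uncurry u₁) (parCyl 0 1)) (hsing₁ : ¬ IsRegularAtOrigin u₁) :
    ∃ (zc : ℕ → ℝ × EuclideanSpace ℝ (Fin 3)) (c : ℕ → ℝ),
      (∀ k, zc k ∈ parCyl (0 : ℝ × EuclideanSpace ℝ (Fin 3)) (1 / 8)) ∧ (∀ k, 0 < c k) ∧
      (∀ k : ℕ, c k ≤ 1 / (20 * ((k : ℝ) + 1))) ∧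
      (∀ k, c k * ‖uncurry u₁ (zc k)‖ = 1 / 2) ∧
      (∀ a : ℝ, 0 < a → ∀ᶠ k in atTop,
        ContinuousOn (uncurry (c k • stPull (c k ^ 2) (c k) (zc k).1 (zc k).2 u₁)) (parCylTop a)) ∧
      (∀ a : ℝ, 0 < a → ∀ᶠ k in atTop, ∀ z ∈ parCylTop a,
        ‖(c k • stPull (c k ^ 2) (c k) (zc k).1 (zc k).2 u₁) z.1 z.2‖ ≤ 1) := by
  obtain ⟨zc, d, h⟩ := exists_centres hcont₁ hsing₁
  set M : ℕ → ℝ := fun k => ‖uncurry u₁ (zc k)‖ with hM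
  set c : ℕ → ℝ := fun k => 1 / (2 * M k) with hc
  have hsc : ∀ k, 0 < M k ∧ 0 < c k ∧ c k * (2 * M k) = 1 ∧ c k ≤ 1 / 20 ∧
      (k : ℝ) + 1 ≤ M k * d k ∧ c k * (M k * d k) = d k / 2 ∧ d k / 2 ≤ 1 / 20 := fun k =>
    scales_of_centre (h k).2.1 (h k).2.2.1 (h k).2.2.2.1
  have h18 : parCyl (0 : ℝ × EuclideanSpace ℝ (Fin 3)) (1 / 8) ⊆ parCyl 0 1 :=
    parCyl_mono 0 (by norm_num) (by norm_num)
  refine ⟨zc, c, fun k => (h k).1, fun k => (hsc k).2.1,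
    fun k => scale_le_of_centre (h k).2.1 (h k).2.2.1 (h k).2.2.2.1, fun k => ?_,
    fun a ha => ?_, fun a ha => ?_⟩
  · have := (hsc k).2.2.1
    show c k * M k = 1 / 2
    linarith
  · filter_upwards [eventually_le_natCast_add_one a] with k hk
    have hcR : c k * a ≤ d k / 2 := by
      rw [← (hsc k).2.2.2.2.2.1]
      exact mul_le_mul_of_nonneg_left (hk.trans (hsc k).2.2.2.2.1) (hsc k).2.1.le
    exact continuousOn_rescaled hcont₁ (hsc k).2.1 ha.le hcR ((h k).2.2.2.2.2.trans h18)
  · filter_upwards [eventually_le_natCast_add_one a] with k hk z hz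
    have hcR : c k * a ≤ d k / 2 := by
      rw [← (hsc k).2.2.2.2.2.1]
      exact mul_le_mul_of_nonneg_left (hk.trans (hsc k).2.2.2.2.1) (hsc k).2.1.le
    exact norm_rescaled_le_one (hsc k).2.1 ha.le hcR (h k).2.2.2.2.1 (hsc k).2.2.1.le hz

/-! ### The clamped rescaled pressures -/

section Pressure

variable {u₁ : ℝ → EuclideanSpace ℝ (Fin 3) → EuclideanSpace ℝ (Fin 3)}
  {p₁ : ℝ → EuclideanSpace ℝ (Fin 3) → ℝ}
  {zc : ℕ → ℝ × EuclideanSpace ℝ (Fin 3)} {c : ℕ → ℝ}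

/-- Freezing the pressure below `t = -1/2` keeps a classical solution on `]-1/2, 0[`.
[folklore] -/
theorem isClassical_clamped (hcl₁ : IsClassicalNSSolutionOn (Ioo (-1 : ℝ) 0) 1 0 u₁ p₁) :
    IsClassicalNSSolutionOn (Ioo (-(1 / 2) : ℝ) 0) 1 0 u₁ fun t x => p₁ (max t (-(1 / 2))) x :=
  (hcl₁.mono (Ioo_subset_Ioo (by norm_num) le_rfl) (uniqueDiffOn_Ioo _ _)).congr_pressure
    fun t ht => by
      funext x
      rw [max_eq_left ht.1.le]

/-- For `s ≤ 0` the time `t_k + c_k² s` of the blow-up is `< 0`, so its clamp `· ∨ (-1/2)` lies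
in `[-1/2, 0[ ⊆ ]-1, 0[`. [folklore] -/
theorem clampedTime_mem (hzc : ∀ k, zc k ∈ parCyl (0 : ℝ × EuclideanSpace ℝ (Fin 3)) (1 / 8))
    (k : ℕ) {s : ℝ} (hs : s ≤ 0) :
    max ((zc k).1 + c k ^ 2 * s) (-(1 / 2)) ∈ Ioo (-1 : ℝ) 0 := by
  have h1 := ((mem_parCyl_zero.1 (hzc k)).1).2
  have h2 : c k ^ 2 * s ≤ 0 := mul_nonpos_of_nonneg_of_nonpos (sq_nonneg _) hs
  refine ⟨lt_of_lt_of_le (by norm_num) (le_max_right _ _), max_lt (by linarith) (by norm_num)⟩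

/-- **The clamped rescaled pressures are continuous on `{s ≤ 0} × ℝ³`.** [folklore] -/
theorem continuousOn_clampedPressure (hcl₁ : IsClassicalNSSolutionOn (Ioo (-1 : ℝ) 0) 1 0 u₁ p₁)
    (hzc : ∀ k, zc k ∈ parCyl (0 : ℝ × EuclideanSpace ℝ (Fin 3)) (1 / 8)) (k : ℕ) :
    ContinuousOn (uncurry (c k ^ 2 • stPull (c k ^ 2) (c k) (zc k).1 (zc k).2
      (fun t x => p₁ (max t (-(1 / 2))) x))) (Iic 0 ×ˢ univ) := by
  have hp : ContinuousOn (uncurry p₁) (Ioo (-1 : ℝ) 0 ×ˢ univ) := hcl₁.smooth_pressure.continuousOn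
  set Φ : ℝ × EuclideanSpace ℝ (Fin 3) → ℝ × EuclideanSpace ℝ (Fin 3) := fun w =>
    (max ((zc k).1 + c k ^ 2 * w.1) (-(1 / 2)), (zc k).2 + c k • w.2) with hΦ
  have hΦc : Continuous Φ := by
    simp only [hΦ]
    fun_prop
  have hmaps : MapsTo Φ (Iic (0 : ℝ) ×ˢ (univ : Set (EuclideanSpace ℝ (Fin 3))))
      (Ioo (-1 : ℝ) 0 ×ˢ univ) := fun w hw => ⟨clampedTime_mem hzc k hw.1, mem_univ _⟩
  have e : uncurry (c k ^ 2 • stPull (c k ^ 2) (c k) (zc k).1 (zc k).2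
      (fun t x => p₁ (max t (-(1 / 2))) x)) = fun w => c k ^ 2 * uncurry p₁ (Φ w) := by
    funext w
    simp only [hΦ, uncurry, Pi.smul_apply, stPull_apply, smul_eq_mul]
  rw [e]
  exact continuousOn_const.mul (hp.comp hΦc.continuousOn hmaps)

/-- **The rescaled pairs solve Navier–Stokes in `𝒟'(Q(a))` for large `k`**: `(U_k, q_k)` is the
Navier–Stokes zoom (KNSS 2009, (6.2)) of the classical pair `(u₁, p₁(· ∨ (-1/2)))` about `z_k`,
classical on the open time set `{s | t_k + c_k² s ∈ ]-1/2, 0[} ⊇ ]-a², 0[` once `c_k a ≤ 1/2`,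
hence distributional on `Q(a)` (CKN 1982, (2.2)). [cite: CaffarelliKohnNirenberg1982, §2 (2.2)] -/
theorem eventually_isDistributional_clamped
    (hcl₁ : IsClassicalNSSolutionOn (Ioo (-1 : ℝ) 0) 1 0 u₁ p₁)
    (hzc : ∀ k, zc k ∈ parCyl (0 : ℝ × EuclideanSpace ℝ (Fin 3)) (1 / 8)) (hc0 : ∀ k, 0 < c k)
    (hc1 : ∀ k : ℕ, c k ≤ 1 / (20 * ((k : ℝ) + 1))) (a : ℝ) :
    ∀ᶠ k in atTop, IsDistributionalNSSolutionOn (parCylOpens 0 a) 1 0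
      (c k • stPull (c k ^ 2) (c k) (zc k).1 (zc k).2 u₁)
      (c k ^ 2 • stPull (c k ^ 2) (c k) (zc k).1 (zc k).2 (fun t x => p₁ (max t (-(1 / 2))) x)) := by
  filter_upwards [eventually_scale_mul_le hc0 hc1 |a| one_half_pos] with k hk
  have hclk := (isClassical_clamped hcl₁).nsRescale_translate_zero (hc0 k) (zc k).1 (zc k).2
  have hopen : IsOpen ((fun r => (zc k).1 + c k ^ 2 * r) ⁻¹' Ioo (-(1 / 2) : ℝ) 0) :=
    isOpen_Ioo.preimage (by fun_prop)
  refine isDistributional_of_classical hopen hclk fun z hz => ⟨?_, mem_univ _⟩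
  have ht := (mem_parCyl_zero.1 hz).1
  have h1 := ((mem_parCyl_zero.1 (hzc k)).1)
  have hck : 0 < c k := hc0 k
  have hz1 : -a ^ 2 < z.1 := ht.1
  have hz2 : z.1 < 0 := ht.2
  have hca : c k ^ 2 * a ^ 2 ≤ 1 / 4 := by
    have : (c k * |a|) ^ 2 ≤ (1 / 2) ^ 2 := pow_le_pow_left₀ (by positivity) hk 2
    rw [mul_pow, sq_abs] at this
    linarith
  simp only [mem_preimage, mem_Ioo]
  constructor
  · nlinarith [h1.1, mul_pos (pow_pos hck 2) (neg_pos.2 hz2)]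
  · nlinarith [h1.2, mul_neg_of_pos_of_neg (pow_pos hck 2) hz2]

/-- **`D(Q(z,r); q_k) ≤ 𝐈₀` for large `k`.** If `D` of the gauged zoomed pressure
`p₁ - g` is bounded by `𝐈₀` on every parabolic ball inside `Q(0, 1/2)`, then so is `D` of the
clamped rescaled pressures on every fixed ball below `s = 0`, for large `k`: `D` is
scale-invariant (`cknDOsc_nsZoom`), the image ball `Q(Φ_k z, c_k r)` lies in `Q(0, 1/2)` for large
`k`, where the clamp is inactive, and `D` does not see the function of time `g`.
[cite: AlbrittonBarker2019, §3 (3.3)] -/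
theorem eventually_cknDOsc_clamped_le
    (hcl₁ : IsClassicalNSSolutionOn (Ioo (-1 : ℝ) 0) 1 0 u₁ p₁)
    (hzc : ∀ k, zc k ∈ parCyl (0 : ℝ × EuclideanSpace ℝ (Fin 3)) (1 / 8)) (hc0 : ∀ k, 0 < c k)
    (hc1 : ∀ k : ℕ, c k ≤ 1 / (20 * ((k : ℝ) + 1))) {g : ℝ → ℝ} {I₀ : ℝ≥0∞}
    (hIq : ∀ ρ : ℝ, 0 < ρ → ∀ z' : ℝ × EuclideanSpace ℝ (Fin 3),
      parabolicCylinder ρ z' ⊆ parabolicCylinder (1 / 2) (0 : ℝ × EuclideanSpace ℝ (Fin 3)) →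
        cknDOsc ρ z' (fun t x => p₁ t x - g t) ≤ I₀)
    {r : ℝ} (hr : 0 < r) {z : ℝ × EuclideanSpace ℝ (Fin 3)} (hz : z.1 ≤ 0) :
    ∀ᶠ k in atTop, cknDOsc r z (c k ^ 2 • stPull (c k ^ 2) (c k) (zc k).1 (zc k).2
      (fun t x => p₁ (max t (-(1 / 2))) x)) ≤ I₀ := by
  filter_upwards [eventually_parabolicCylinder_stAffine_subset_half hzc hc0 hc1 hz hr] with k hk
  rw [cknDOsc_nsZoom (hc0 k) hr]
  set ρ : ℝ := c k * r with hρ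
  set z' : ℝ × EuclideanSpace ℝ (Fin 3) := stAffine (c k ^ 2) (c k) (zc k).1 (zc k).2 z with hz'
  have hρ0 : 0 < ρ := mul_pos (hc0 k) hr
  -- times of the image ball lie in `]-1/4, 0[`
  have htime : ∀ t ∈ Ioo (z'.1 - ρ ^ 2) z'.1, -(1 / 4) < t ∧ t < 0 := by
    intro t ht
    have hw : ((t, z'.2) : ℝ × EuclideanSpace ℝ (Fin 3)) ∈ parabolicCylinder ρ z' :=
      ⟨ht, mem_ball_self hρ0⟩
    have h2 := hk hw
    rw [parabolicCylinder_zero_eq] at h2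
    exact ⟨by nlinarith [h2.1.1], h2.1.2⟩
  have h1 : cknDOsc ρ z' (fun t x => p₁ (max t (-(1 / 2))) x) = cknDOsc ρ z' p₁ :=
    cknDOsc_congr_slices fun t ht => by
      funext x
      rw [max_eq_left (by linarith [(htime t ht).1])]
  have h2 : cknDOsc ρ z' (fun t x => p₁ t x - g t) = cknDOsc ρ z' p₁ :=
    cknDOsc_sub_timeFun' (fun t ht => (hcl₁.contDiff_pressure
      ⟨by linarith [(htime t ht).1], (htime t ht).2⟩).continuous.locallyIntegrable) g hρ0
  rw [h1, ← h2]
  exact hIq ρ hρ0 z' hk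

end Pressure

/-! ### Uniform local `L^{3/2}` bounds of the gauged pressures -/

/-- **The pressure input of the compactness step.** If the rescaled pressures `q_k` are
continuous on `{s ≤ 0} × ℝ³`, solve Navier–Stokes with `U_k` in `𝒟'(Q(a))` for large `k`, and
have `D(Q(z,r); q_k) ≤ 𝐈₀ < ∞` for large `k` on balls below `s = 0`, then on every `Q(a)` the
gauged pressures `q̃_k` are admissible pressures with `∫∫_{Q(a)} |q̃_k|^{3/2}` bounded uniformly
for large `k`. [cite: AlbrittonBarker2019, §3 (3.4)] -/
theorem exists_pressure_bound
    {U : ℕ → ℝ → EuclideanSpace ℝ (Fin 3) → EuclideanSpace ℝ (Fin 3)}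
    {Pq : ℕ → ℝ → EuclideanSpace ℝ (Fin 3) → ℝ} {I₀ : ℝ≥0∞}
    (hPc : ∀ k, ContinuousOn (uncurry (Pq k)) (Iic 0 ×ˢ univ))
    (hNSR : ∀ a : ℝ, 0 < a → ∀ᶠ k in atTop,
      IsDistributionalNSSolutionOn (parCylOpens 0 a) 1 0 (U k) (Pq k))
    (hD : ∀ r : ℝ, 0 < r → ∀ z : ℝ × EuclideanSpace ℝ (Fin 3), z.1 ≤ 0 →
      ∀ᶠ k in atTop, cknDOsc r z (Pq k) ≤ I₀)
    (hI : I₀ ≠ ⊤) (a : ℝ) (ha : 0 < a) :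
    ∃ cst : ℝ≥0, ∀ᶠ k in atTop, ∃ P : ℝ → EuclideanSpace ℝ (Fin 3) → ℝ,
      IsDistributionalNSSolutionOn (parCylOpens 0 a) 1 0 (U k) P ∧
        ∫⁻ z in parCyl 0 a, ‖P z.1 z.2‖ₑ ^ (3 / 2 : ℝ) ≤ cst := by
  set m : ℕ := ⌈2 * a⌉₊ with hm
  have hsub : parCyl (0 : ℝ × EuclideanSpace ℝ (Fin 3)) a ⊆
      parabolicCylinder ((m : ℝ) + 2) (0 : ℝ × EuclideanSpace ℝ (Fin 3)) := by
    refine (parCyl_zero_subset_parabolicCylinder a).trans (parabolicCylinder_mono (by positivity) ?_ 0)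
    have : 2 * a ≤ (m : ℝ) := Nat.le_ceil (2 * a)
    linarith
  refine ⟨(2 ^ (1 / 2 : ℝ) * (1 + volume (ball (0 : EuclideanSpace ℝ (Fin 3)) ((m : ℝ) + 2)) *
      (volume (closedBall (0 : EuclideanSpace ℝ (Fin 3)) 1))⁻¹) *
    (ENNReal.ofReal ((m : ℝ) + 2) ^ 2 * I₀)).toNNReal, ?_⟩
  filter_upwards [hNSR a ha, eventually_lintegral_gauged_le (Eventually.of_forall hPc) hD m]
    with k hk hbk
  refine ⟨fun s y => Pq k s y - ⨍ y' in closedBall (0 : EuclideanSpace ℝ (Fin 3)) 1,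
    Pq k (min s 0) y', isDistributional_gauged (hPc k) hk, ?_⟩
  rw [ENNReal.coe_toNNReal (levelConst_ne_top hI m)]
  exact (lintegral_mono_set hsub).trans hbk

end HardyAncientLimit

end Summit.NavierStokesRegularity.NavierStokesRegularity.Theorems

end
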